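import Summits.Schanuel.Schanuel.Theorems.RootDecomp1EGenericityFloor02

/-!
# RootDecomp1EGenericityFloor — lens 2, generation 38: THE GENERICITY FLOOR of route RootDecomp1E (RULE E-R19's yardstick) — continuation (RootDecomp1EGenericityFloor03): THE GENERICITY FLOOR `countable_bad_scales_complex` / `_range` / `countable_bad_scales` / `floor_of_embedding` and the yardsticks `countable_not_schanuel_of_defectOne` / `_of_schanuel`

(lens-2 g38 GENERICITY FLOOR [HOME/decomp-schanuel-lens-2/g38/port/RootDecomp1EGenericityFloor01.lean 5821235e… (256 l) + …02.lean ca3de805… (305 l), copy-ready per NOTE L1838; source GenericScale.lean §7 (ed.1 b58a0d29… / ed.2 cf4f06e4…); critic VERDICT L1833 (C): INSTRUMENT «GENERICITY FLOOR» ACCEPTED on service lane (α) as the 1E YARDSTICK of RULE E-R19; PORT GO own chain]; port by census-1 gen 16 in three parts — see the PORT NOTE of part 01; `--supports stmt-Schanuel-31409`; rung 0.)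
-/

noncomputable section

open Complex MvPolynomial
open scoped IntermediateField.algebraAdjoinAdjoin
namespace Summit.Schanuel.Schanuel.Theorems.RootDecomp1EGenericityFloor

open Filter Topology

variable {k : ℕ}

/-- an (unanchored) maximal algebraically independent sub-family of the coordinates of a point -/
private theorem exists_finset_algebraicIndependent_maximal {ι : Type} [Fintype ι] (P : ι → ℂ) :
    ∃ S : Finset ι, AlgebraicIndependent ℚ (fun i : S => P i) ∧
      ∀ j, IsAlgebraic (Algebra.adjoin ℚ (Set.range fun i : S => P i)) (P j) := by
  classical
  let good : Finset ι → Prop := fun S => AlgebraicIndependent ℚ (fun i : S => P i)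
  have hgood0 : good ∅ := by
    haveI : IsEmpty {i // i ∈ (∅ : Finset ι)} := ⟨fun i => Finset.notMem_empty _ i.2⟩
    exact algebraicIndependent_empty_type
  have hne : ((Finset.univ : Finset (Finset ι)).filter good).Nonempty := ⟨∅, by simpa using hgood0⟩
  obtain ⟨S, hS, hmax⟩ := Finset.exists_max_image _ Finset.card hne
  simp only [Finset.mem_filter, Finset.mem_univ, true_and] at hS hmax
  refine ⟨S, hS, fun j => ?_⟩
  by_contra htr
  have hopt : AlgebraicIndependent ℚ (fun o : Option S => o.elim (P j) (fun i : S => P i)) :=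
    (hS.option_iff_transcendental (P j)).mpr htr
  have hjS : j ∉ S := by
    intro hj
    exact htr (isAlgebraic_algebraMap
      (⟨P j, Algebra.subset_adjoin ⟨⟨j, hj⟩, rfl⟩⟩ : Algebra.adjoin ℚ (Set.range fun i : S => P i)))
  let f : {i // i ∈ insert j S} → Option S := fun i =>
    if h : (i : ι) ∈ S then some ⟨i, h⟩ else none
  have hf_of_not : ∀ i : {i // i ∈ insert j S}, (i : ι) ∉ S → (i : ι) = j := fun i hi => by
    have := i.2
    rw [Finset.mem_insert] at this
    tauto
  have hf : Function.Injective f := by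
    intro a b hab
    by_cases ha : (a : ι) ∈ S <;> by_cases hb : (b : ι) ∈ S
    · simp only [f, ha, hb, dif_pos, Option.some.injEq, Subtype.mk.injEq] at hab
      exact Subtype.ext hab
    · simp [f, ha, hb] at hab
    · simp [f, ha, hb] at hab
    · exact Subtype.ext ((hf_of_not a ha).trans (hf_of_not b hb).symm)
  have hgood : good (insert j S) := by
    have hcomp := hopt.comp f hf
    have hfun : ((fun o : Option S => o.elim (P j) (fun i : S => P i)) ∘ f) =
        fun i : {i // i ∈ insert j S} => P i := by
      funext i
      by_cases h : (i : ι) ∈ S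
      · simp [f, h]
      · simp [f, hf_of_not i h, hjS]
    show AlgebraicIndependent ℚ (fun i : {i // i ∈ insert j S} => P i)
    simpa only [hfun] using hcomp
  have := hmax _ hgood
  rw [Finset.card_insert_of_notMem hjS] at this
  omega

/-- With `S` as above, `trdeg_ℚ ℚ(P) ≤ #S`. (Verbatim copy of `Literature.NumberTheory.Transcendental.
TrdegZariskiDim.trdeg_adjoin_le_card` — copied, not imported, only because that module was not built on
the farm at the time of writing.) [folklore] -/
private theorem trdeg_adjoin_le_card {ι : Type} (P : ι → ℂ) (S : Finset ι)
    (halg : ∀ j, IsAlgebraic (Algebra.adjoin ℚ (Set.range fun i : S => P i)) (P j)) :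
    Algebra.trdeg ℚ (IntermediateField.adjoin ℚ (Set.range P)) ≤ S.card := by
  classical
  set x : S → ℂ := fun i => P i with hx
  set T : Set ℂ := Set.range x with hT
  let R₀ : Subalgebra ℚ ℂ := Algebra.adjoin ℚ T
  let E₀ : IntermediateField ℚ ℂ := IntermediateField.adjoin ℚ T
  let E : IntermediateField ℚ ℂ := IntermediateField.adjoin ℚ (Set.range P)
  have halgE₀ : ∀ j, IsAlgebraic E₀ (P j) := fun j =>
    IntermediateField.isAlgebraic_adjoin_iff.mpr (halg j)
  have hEle : E ≤ (algebraicClosure E₀ ℂ).restrictScalars ℚ := by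
    refine IntermediateField.adjoin_le_iff.mpr ?_
    rintro _ ⟨j, rfl⟩
    exact mem_algebraicClosure_iff.mpr (halgE₀ j)
  have halgR₀ : ∀ e : E, IsAlgebraic R₀ (e : ℂ) := fun e =>
    (IsFractionRing.isAlgebraic_iff R₀ E₀ ℂ).mpr (mem_algebraicClosure_iff.mp (hEle e.2))
  have hmemE : ∀ i, P i ∈ E := fun i => IntermediateField.subset_adjoin _ _ ⟨i, rfl⟩
  let y : S → E := fun a => ⟨P a, hmemE a⟩
  let sE : Set E := Set.range y
  let v : E →ₐ[ℚ] ℂ := (algebraMap E ℂ).toRatAlgHom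
  have hvinj : Function.Injective v := (algebraMap E ℂ).injective
  have himage : (v : E → ℂ) '' sE = T := by
    apply Set.Subset.antisymm
    · rintro _ ⟨_, ⟨a, rfl⟩, rfl⟩
      exact ⟨a, rfl⟩
    · rintro _ ⟨a, rfl⟩
      exact ⟨y a, ⟨a, rfl⟩, rfl⟩
  have hmap : (Algebra.adjoin ℚ sE).map v = R₀ := by
    rw [AlgHom.map_adjoin, himage]
  let e₁ : Algebra.adjoin ℚ sE ≃ₐ[ℚ] R₀ :=
    (Subalgebra.equivMapOfInjective _ v hvinj).trans (Subalgebra.equivOfEq _ _ hmap)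
  have he₁ : ∀ r : Algebra.adjoin ℚ sE, ((e₁ r : R₀) : ℂ) = ((r : E) : ℂ) := fun r => by
    have h := Subalgebra.coe_equivMapOfInjective_apply (Algebra.adjoin ℚ sE) v hvinj r
    simp only [e₁, AlgEquiv.trans_apply, Subalgebra.equivOfEq_apply]
    rw [h]
    rfl
  haveI : Algebra.IsAlgebraic (Algebra.adjoin ℚ sE) E := by
    refine ⟨fun e => ?_⟩
    refine IsAlgebraic.of_ringHom_of_comp_eq (f := e₁.toAlgHom.toRingHom) (g := algebraMap E ℂ)
      (halgR₀ e) e₁.surjective (algebraMap E ℂ).injective ?_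
    ext r
    exact he₁ r
  calc Algebra.trdeg ℚ E ≤ Cardinal.mk sE := Algebra.IsAlgebraic.trdeg_le_cardinalMk ℚ sE
    _ ≤ Cardinal.mk S := Cardinal.mk_range_le
    _ = S.card := Cardinal.mk_coe_finset

/-- `k` algebraically independent elements of `L` give `k ≤ trdeg_ℚ L`. [folklore]
(Twin of `RootDecomp1BDefectFloorCells.natCast_le_trdeg_of_algebraicIndependent`, restated to keep this
instrument free of route-1B imports.) -/
private theorem natCast_le_trdeg_of_algebraicIndependent {k : ℕ} {L : IntermediateField ℚ ℂ}
    {z : Fin k → ℂ} (hz : AlgebraicIndependent ℚ z) (hmem : ∀ i, z i ∈ L) :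
    (k : Cardinal) ≤ Algebra.trdeg ℚ ↥L := by
  let z' : Fin k → ↥L := fun i => ⟨z i, hmem i⟩
  have hz' : AlgebraicIndependent ℚ z' := AlgebraicIndependent.of_comp L.val hz
  simpa using hz'.cardinalMk_le_trdeg

/-- countability of rational polynomials in finitely many variables [folklore] -/
private theorem countable_mvPolynomial_rat (n : ℕ) : Countable (MvPolynomial (Fin n) ℚ) :=
  Function.Injective.countable
    (f := (AddMonoidAlgebra.coeff : MvPolynomial (Fin n) ℚ → (Fin n →₀ ℕ) →₀ ℚ))
    AddMonoidAlgebra.coeff_injective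

/-- **THE GENERICITY FLOOR (E-R19), complex-parameter range form.** For every `w : Fin m → ℂ` and
`i₀` with `w_{i₀} ≠ 0` there is a countable exceptional set of COMPLEX `u` outside which EVERY tuple `z`
containing the coordinates of `w` and the coordinate `u·w_{i₀}` satisfies
`trdeg ℚ(z, e^z) ≥ trdeg ℚ(w, e^w) + 2`. -/
theorem countable_bad_scales_complex {m : ℕ} (w : Fin m → ℂ) (i₀ : Fin m) (hc : w i₀ ≠ 0) :
    {ρ : ℂ | ∃ (n : ℕ) (z : Fin n → ℂ), Set.range w ⊆ Set.range z ∧ ρ * w i₀ ∈ Set.range z ∧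
      ¬ (Algebra.trdeg ℚ ↥(IntermediateField.adjoin ℚ
          (Set.range w ∪ Set.range (Complex.exp ∘ w))) + 2 ≤
        Algebra.trdeg ℚ ↥(IntermediateField.adjoin ℚ
          (Set.range z ∪ Set.range (Complex.exp ∘ z))))}.Countable := by
  classical
  set c : ℂ := w i₀ with hcdef
  set v : Fin (m + m) → ℂ := coordFamily w with hv
  obtain ⟨S, hSai, hSalg⟩ := exists_finset_algebraicIndependent_maximal v
  have htr_le := trdeg_adjoin_le_card v S hSalg
  rw [hv, range_coordFamily w] at htr_le
  set k : ℕ := S.card with hk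
  obtain ⟨eS, heS⟩ : ∃ eS : S ≃ Fin k, eS = S.equivFin := ⟨_, rfl⟩
  let f : Fin k → Fin (m + m) := fun i => (eS.symm i : S)
  have hθ : AlgebraicIndependent ℚ (v ∘ f) := hSai.comp _ eS.symm.injective
  set θ : Fin k → ℂ := v ∘ f with hθdef
  -- the countable family of exceptional sets
  haveI := countable_mvPolynomial_rat (k + 2)
  let Z : MvPolynomial (Fin (k + 2)) ℚ → Set ℂ := fun P =>
    if P = 0 then ∅ else {ρ : ℂ | expPoly θ c P ρ = 0}
  have hZ : ∀ P, (Z P).Countable := by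
    intro P
    by_cases hP : P = 0
    · simp [Z, hP]
    · simp only [Z, hP, if_false]
      obtain ⟨t₀, ht₀⟩ := exists_expPoly_ne_zero hθ hc hP
      exact countable_zeros_of_analyticOnNhd (analyticOnNhd_expPoly θ c P) ht₀
  refine (Set.countable_iUnion hZ).mono ?_
  intro ρ hρ
  simp only [Set.mem_setOf_eq] at hρ
  obtain ⟨n, z, hwz, hρz, hbad⟩ := hρ
  rw [Set.mem_iUnion]
  by_contra hnot
  push Not at hnot
  apply hbad
  -- ρ outside every Z P: the family (e^{cρ}, ρ, θ) is algebraically independent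
  have hai : AlgebraicIndependent ℚ
      (Fin.cons (cexp (c * ρ)) (Fin.cons ρ θ) : Fin (k + 2) → ℂ) := by
    rw [algebraicIndependent_iff]
    intro P hPv
    by_contra hP0
    have : ρ ∈ Z P := by
      simp only [Z, hP0, if_false, Set.mem_setOf_eq, expPoly]
      exact hPv
    exact hnot P this
  -- count inside F = ℚ(z, e^z)
  set F := IntermediateField.adjoin ℚ (Set.range z ∪ Set.range (Complex.exp ∘ z)) with hF
  have hzF : ∀ i, z i ∈ F := fun i => IntermediateField.subset_adjoin _ _ (Or.inl ⟨i, rfl⟩)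
  have hezF : ∀ i, cexp (z i) ∈ F := fun i => IntermediateField.subset_adjoin _ _ (Or.inr ⟨i, rfl⟩)
  have hwF : ∀ i : Fin m, w i ∈ F := fun i => by
    obtain ⟨j, hj⟩ := hwz ⟨i, rfl⟩
    rw [← hj]; exact hzF j
  have hewF : ∀ i : Fin m, cexp (w i) ∈ F := fun i => by
    obtain ⟨j, hj⟩ := hwz ⟨i, rfl⟩
    rw [← hj]; exact hezF j
  have hvF : ∀ l, v l ∈ F := by
    intro l
    have : v l ∈ Set.range w ∪ Set.range (cexp ∘ w) := by
      rw [← range_coordFamily w]; exact ⟨l, rfl⟩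
    rcases this with ⟨i, hi⟩ | ⟨i, hi⟩
    · rw [← hi]; exact hwF _
    · rw [← hi, Function.comp_apply]; exact hewF _
  have hcF : c ∈ F := by rw [hcdef]; exact hwF _
  obtain ⟨j₁, hj₁⟩ := hρz
  have hρF : ρ ∈ F := by
    have : ρ = z j₁ / c := by rw [hj₁, mul_div_assoc, div_self hc, mul_one]
    rw [this]; exact div_mem (hzF _) hcF
  have heF : cexp (c * ρ) ∈ F := by
    rw [mul_comm, ← hj₁]; exact hezF _
  have hmem : ∀ i, (Fin.cons (cexp (c * ρ)) (Fin.cons ρ θ) : Fin (k + 2) → ℂ) i ∈ F := by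
    intro i
    refine Fin.cases ?_ (fun i' => Fin.cases ?_ (fun l => ?_) i') i
    · simpa using heF
    · simpa using hρF
    · simpa [hθdef] using hvF (f l)
  have hcard := natCast_le_trdeg_of_algebraicIndependent hai hmem
  calc Algebra.trdeg ℚ ↥(IntermediateField.adjoin ℚ (Set.range w ∪ Set.range (Complex.exp ∘ w))) + 2
      ≤ (k : Cardinal) + 2 := by gcongr
    _ = ((k + 2 : ℕ) : Cardinal) := by push_cast; rfl
    _ ≤ _ := hcard

/-- **THE GENERICITY FLOOR (E-R19), real-scale range form** (preimage of the complex form). -/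
theorem countable_bad_scales_range {m : ℕ} (w : Fin m → ℂ) (i₀ : Fin m) (hc : w i₀ ≠ 0) :
    {ρ : ℝ | ∃ (n : ℕ) (z : Fin n → ℂ), Set.range w ⊆ Set.range z ∧ (ρ : ℂ) * w i₀ ∈ Set.range z ∧
      ¬ (Algebra.trdeg ℚ ↥(IntermediateField.adjoin ℚ
          (Set.range w ∪ Set.range (Complex.exp ∘ w))) + 2 ≤
        Algebra.trdeg ℚ ↥(IntermediateField.adjoin ℚ
          (Set.range z ∪ Set.range (Complex.exp ∘ z))))}.Countable :=
  (countable_bad_scales_complex w i₀ hc).preimage Complex.ofReal_injective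

/-- **THE GENERICITY FLOOR (E-R19).** For every `w : Fin m → ℂ` and `i₀` with `w_{i₀} ≠ 0`, the set of
real `ρ` for which `trdeg ℚ(w, ρ w_{i₀}, e^{w}, e^{ρ w_{i₀}}) ≥ trdeg ℚ(w, e^w) + 2` FAILS is countable. -/
theorem countable_bad_scales {m : ℕ} (w : Fin m → ℂ) (i₀ : Fin m) (hc : w i₀ ≠ 0) :
    {ρ : ℝ | ¬ (Algebra.trdeg ℚ ↥(IntermediateField.adjoin ℚ
        (Set.range w ∪ Set.range (Complex.exp ∘ w))) + 2 ≤
      Algebra.trdeg ℚ ↥(IntermediateField.adjoin ℚ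
        (Set.range (Fin.snoc w ((ρ : ℂ) * w i₀) : Fin (m + 1) → ℂ) ∪
          Set.range (Complex.exp ∘ (Fin.snoc w ((ρ : ℂ) * w i₀) : Fin (m + 1) → ℂ)))))}.Countable := by
  refine (countable_bad_scales_range w i₀ hc).mono ?_
  intro ρ hρ
  simp only [Set.mem_setOf_eq] at hρ ⊢
  refine ⟨m + 1, Fin.snoc w ((ρ : ℂ) * w i₀), ?_, ⟨Fin.last m, by simp⟩, hρ⟩
  rintro _ ⟨i, rfl⟩
  exact ⟨Fin.castSucc i, by simp⟩

/-- the floor in the cells' own currency (lens-2 g38 §5): an embedded sub-tuple `z ∘ ι = w` and a coordinate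
`z j = ρ · z (ι i₀)` outside the range of `ι` — outside the SAME countable set, the floor bound holds. -/
theorem floor_of_embedding {m : ℕ} (w : Fin m → ℂ) (i₀ : Fin m) (hc : w i₀ ≠ 0) :
    {ρ : ℝ | ∃ (n : ℕ) (z : Fin n → ℂ) (ι : Fin m ↪ Fin n) (j : Fin n), z ∘ ι = w ∧
      z j = (ρ : ℂ) * z (ι i₀) ∧
      ¬ (Algebra.trdeg ℚ ↥(IntermediateField.adjoin ℚ
          (Set.range w ∪ Set.range (Complex.exp ∘ w))) + 2 ≤
        Algebra.trdeg ℚ ↥(IntermediateField.adjoin ℚ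
          (Set.range z ∪ Set.range (Complex.exp ∘ z))))}.Countable := by
  refine (countable_bad_scales_range w i₀ hc).mono ?_
  rintro ρ ⟨n, z, ι, j, hzι, hzj, hbad⟩
  refine ⟨n, z, ?_, ⟨j, ?_⟩, hbad⟩
  · rintro _ ⟨i, rfl⟩
    exact ⟨ι i, by rw [← hzι]; rfl⟩
  · rw [hzj, ← hzι]; rfl

/-- **The floor as a yardstick in item currency.** If `w` satisfies the defect-`≤ 1` bound (the content
of the items' induction hypothesis AT `w`), then for all but countably many real `ρ` the extended tuple
`z = (w, ρ·w_{i₀})` satisfies SCHANUEL's bound itself (defect `0`) — strictly MORE than a (b)-cell of §5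
concludes for such `z` (defect `≤ 1`).  This is the critic's E-R19 (F2) comparison, kernel-checked. -/
theorem countable_not_schanuel_of_defectOne {m : ℕ} (w : Fin m → ℂ) (i₀ : Fin m) (hc : w i₀ ≠ 0)
    (hIH : (m : Cardinal) ≤ Algebra.trdeg ℚ ↥(IntermediateField.adjoin ℚ
        (Set.range w ∪ Set.range (Complex.exp ∘ w))) + 1) :
    {ρ : ℝ | ¬ (((m + 1 : ℕ) : Cardinal) ≤ Algebra.trdeg ℚ ↥(IntermediateField.adjoin ℚ
        (Set.range (Fin.snoc w ((ρ : ℂ) * w i₀) : Fin (m + 1) → ℂ) ∪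
          Set.range (Complex.exp ∘ (Fin.snoc w ((ρ : ℂ) * w i₀) : Fin (m + 1) → ℂ)))))}.Countable := by
  refine (countable_bad_scales w i₀ hc).mono ?_
  intro ρ hρ
  simp only [Set.mem_setOf_eq] at hρ ⊢
  intro hfloor
  apply hρ
  calc ((m + 1 : ℕ) : Cardinal) = (m : Cardinal) + 1 := by push_cast; rfl
    _ ≤ Algebra.trdeg ℚ ↥(IntermediateField.adjoin ℚ
          (Set.range w ∪ Set.range (Complex.exp ∘ w))) + 1 + 1 := by gcongr
    _ = Algebra.trdeg ℚ ↥(IntermediateField.adjoin ℚ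
          (Set.range w ∪ Set.range (Complex.exp ∘ w))) + 2 := by
        rw [add_assoc, one_add_one_eq_two]
    _ ≤ _ := hfloor

/-- … and unconditionally in the SCHANUEL-from-SCHANUEL form: if `w` satisfies Schanuel's bound, so does
`(w, ρ·w_{i₀})` for all but countably many real `ρ` (the `n ≤ m + 1` "line" comparison of §5). -/
theorem countable_not_schanuel_of_schanuel {m : ℕ} (w : Fin m → ℂ) (i₀ : Fin m) (hc : w i₀ ≠ 0)
    (hS : (m : Cardinal) ≤ Algebra.trdeg ℚ ↥(IntermediateField.adjoin ℚ
        (Set.range w ∪ Set.range (Complex.exp ∘ w)))) :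
    {ρ : ℝ | ¬ (((m + 1 : ℕ) : Cardinal) + 1 ≤ Algebra.trdeg ℚ ↥(IntermediateField.adjoin ℚ
        (Set.range (Fin.snoc w ((ρ : ℂ) * w i₀) : Fin (m + 1) → ℂ) ∪
          Set.range (Complex.exp ∘ (Fin.snoc w ((ρ : ℂ) * w i₀) : Fin (m + 1) → ℂ)))))}.Countable := by
  refine (countable_bad_scales w i₀ hc).mono ?_
  intro ρ hρ
  simp only [Set.mem_setOf_eq] at hρ ⊢
  intro hfloor
  apply hρ
  calc ((m + 1 : ℕ) : Cardinal) + 1 = (m : Cardinal) + 2 := by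
        push_cast; rw [add_assoc, one_add_one_eq_two]
    _ ≤ Algebra.trdeg ℚ ↥(IntermediateField.adjoin ℚ
          (Set.range w ∪ Set.range (Complex.exp ∘ w))) + 2 := by gcongr
    _ ≤ _ := hfloor

end Summit.Schanuel.Schanuel.Theorems.RootDecomp1EGenericityFloor

end
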